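import Summits.PneNP.GCT.Certificates.MaxDet4D12L27_5_3_2_2_2_2_2_2_1BEval5
import HarnessLib

/-!
# Kernel certificate family (det₄ side, cell `pub-gct-max`, pair 17 generator B): `4 ≤ mult_{λ*} ℂ[Δ(det₄)]_12`, `λ = (27,5,3,2⁶,1)` — EVAL sibling 6 of 6 (kernel `decide` nodes of the split planner for entry chain (0,0), (0,1), (1,0), (1,1), (2,0), (2,1), (3,0), (3,1); 1 declarations)

Imports its predecessor sibling `MaxDet4D12L27_5_3_2_2_2_2_2_2_1BEval5` (V2: single chain).
Sibling of the multi-file certificate `MaxDet4D12L27_5_3_2_2_2_2_2_2_1B` (main file; statements about multiplicities live THERE). Layout =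
generator B design note CERT-DESIGN-B-MULTIFILE.md as accepted by `val-gct-ref-3` (DESIGN-OK-CONDITIONAL V1–V8): Data →
Eval1 → … → EvalK → main, a single import chain; every kernel node keeps the single-file shape (`layersB … = L` /
`layerSumB (layersB …) = s`, each ONE `decide +kernel` of ≤ 4 000 walk outcomes); declarations of earlier siblings are
used by name. Split across files only to respect the 400-line / 200 000-byte limits on `Summits/` files.
HONEST FRAMING: a kernel-checked LOWER bound at small parameters on a row the cell booked det-FULL (census word) —
negative census at the KNOWN separation `(3,4)` (`dc̄(per₃) ≥ 5`), method validation; nothing `(3,5)`; no claim about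
VP ≠ VNP or P ≠ NP. Row `det=4, d=12, λ = (27,5,3,2⁶,1)`, booked `r_Ω = a = 4` (job j247997); generator B = `val-gct-eng-34` gen/ `4b41805eac0c`.
[folklore] bookkeeping.
-/

namespace Summit.PneNP.GCT

open Literature.Computability.AlgebraicComplexity Literature.Computability.AlgebraicComplexity.TableauEval
open _root_.Literature.NumberTheory.DiophantineGeometry

/-! ## §2 Kernel evaluations — segment 6 of 6 -/

/-- **Kernel computation (3,3)**: functional #3 at det₄-point #3 evaluates to `25242` modulo `65537`
(exact value `-38373477580800`; one `decide +kernel` of `evalB`; layer sizes 1/2/11/15/48/85/90/57/20/26/6/3, 1529 walk outcomes, 379 trie leaves).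
[folklore] -/
theorem certB_12_27_5_3_2_2_2_2_2_2_1_evalB_3_3 :
    evalB (certB_12_27_5_3_2_2_2_2_2_2_1.pointModDet 65537 3) certB_12_27_5_3_2_2_2_2_2_2_1_net3 = (25242 : ZMod 65537) := by
  set_option maxHeartbeats 0 in decide +kernel

end Summit.PneNP.GCT
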